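import Literature.AnabelianGeometry.EtaleTheta.Discharge.Sec3Thm37Cnst
import Literature.AnabelianGeometry.EtaleTheta.Discharge.Sec3RlfEffectiveWeak
import Literature.AnabelianGeometry.EtaleTheta.RealifiedDivisorMonoidsOfRlfWeak
import HarnessLib

/-!
# [EtTh] Prop 3.4 (ii) relative to `D^cnst`: transport to the Def. 3.6 (i) data of monoid type `ℤ`
# constructed over the WEAK vocabulary (`RealifiedDivisorMonoids.ofRlfZWeak`) — PROVED

Proof-only companion (theorems only, no definitions), the weak-vocabulary twin of
`Discharge/Sec3Prop34CnstOfRlfZ.lean` (abc-iut-L2-t3).  S. Mochizuki, *The étale theta function …*, Publ. RIMS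
**45** (2009) [EtTh], Prop. 3.4 (ii) p.74, Def. 3.6 (i) p.76, Thm. 3.7 (iii) pp.79–80 (PDF)
[cite: MochizukiEtTh2009, Prop 3.4 (ii) p.74].  For the Def. 3.6 (i) data of monoid type `ℤ` CONSTRUCTED
from Def. 3.3 (iii) data `dm` whose divisor monoids `Φ₀(Y)` are weakly perf-factorial with cofinal perfection
(`treeMonoidVocabWeak.IsPerfFactorial = IsPerfFactorialCof`; cell findings F-L2d2-1/F-L2d2-2: the notion that
holds at tempered coverings with infinitely many special-fibre components) — `RealifiedDivisorMonoids.ofRlfZWeak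
dm hpf` (abc-iut-L6-t12): `Φ₀^ℝ := Φ₀^rlf` (weak realification functor), `B₀^ℤ := B₀`, `F₀^ℤ := F₀` — the
Prop. 3.4 (ii) clauses relative to `D^cnst` (`RealifiedDivisorMonoids.Prop34Cnst`, the hypothesis of Thm. 3.7
(iii) in `Discharge/Sec3Thm37Cnst.lean`) follow from the `B₀`-level `dm.Prop34` and `dm.Prop34Cnst₀`, via
`RlfEffective.exists_eq_of_weak`.

* `RealifiedDivisorMonoids.Prop34Cnst.ofRlfZWeak`;
* `TemperedFrobenioid.thm37_iii_withCnst_ofRlfZWeak` — Theorem 3.7 (iii), as typed, for every tempered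
  Frobenioid over `ofRlfZWeak dm hpf`, modulo `B₀`-level statements only.
HONEST FRAMING: refereed pre-IUT material; nothing here bears on [IUTchIII] Cor. 3.12; here PROVED.
-/

noncomputable section

namespace Literature.AnabelianGeometry.EtaleTheta

open CategoryTheory Opposite Literature.AlgebraicGeometry.Frobenioids

universe u₀ v₀ u₁ v₁ u v w

namespace RealifiedDivisorMonoids.Prop34Cnst

variable {D₀ : Type u} [Category.{v} D₀] {dm : DivisorMonoids.{u, v, w} D₀}
  {hpf : ∀ Y : D₀ᵒᵖ, IsPerfFactorialCof (dm.Φ₀.obj Y)} {V : FrdIMonoidStub.{w}}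
  {V₀ : FrdICatStub.{u, v, w} D₀} {Dcnst : Type u₁} [Category.{v₁} Dcnst] {cnst : D₀ ⥤ Dcnst}

/-- **Prop. 3.4 (ii) relative to `D^cnst` for the weak-vocabulary constructed Def. 3.6 (i) data of monoid
type `ℤ`**: for `T = ofRlfZWeak dm hpf`, `Prop34Cnst T cnst` follows from `dm.Prop34` (effective locus ⊆ `F₀`)
and `dm.Prop34Cnst₀ cnst` — effectivity of the image in `(Φ₀^rlf)^gp` being detected in `Φ₀` for the WEAKLY
perf-factorial `Φ₀(Y)` (`RlfEffective.exists_eq_of_weak`). [cite: MochizukiEtTh2009, Prop 3.4 (ii) p.74] -/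
theorem ofRlfZWeak (h34 : dm.Prop34 V V₀) (h₀ : dm.Prop34Cnst₀ cnst) :
    (RealifiedDivisorMonoids.ofRlfZWeak dm hpf).Prop34Cnst cnst where
  mem_FΛ_of_divΛ_eq_of Y b x hbx := by
    obtain ⟨x₀, hx₀, -⟩ := RlfEffective.exists_eq_of_weak (hpf Y).weak (dm.div₀ Y b) x hbx
    exact h34.mem_F₀_of_div₀_mem Y b x₀ hx₀
  BΛ_map_eq_of_cnst_map_eq g g' hg b hb := h₀.B₀_map_eq_of_cnst_map_eq g g' hg b hb
  ΦR_map_eq_of_cnst_map_eq := by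
    rintro Y Y' g g' hg x ⟨b, hb, hbx⟩
    obtain ⟨x₀, hx₀, rfl⟩ := RlfEffective.exists_eq_of_weak (hpf (op Y')).weak (dm.div₀ (op Y') b) x hbx
    change rlfMapWeak dm.Φ₀ hpf g.op ((hpf (op Y')).weak.toRealification (Perfection.of _ x₀)) =
      rlfMapWeak dm.Φ₀ hpf g'.op ((hpf (op Y')).weak.toRealification (Perfection.of _ x₀))
    rw [rlfMapWeak_toRealification_of, rlfMapWeak_toRealification_of,
      h₀.Φ₀_map_eq_of_cnst_map_eq g g' hg x₀ ⟨b, hb, hx₀⟩]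
  cnst_map_eq_of_BΛ_map_eq _ Y g g' hker := by
    refine h₀.cnst_map_eq_of_B₀_map_eq g g' fun b hb => hker b ?_
    change gpMap (((toRlfNatTransWeak dm.Φ₀ hpf).app (op Y)).hom) (dm.div₀ (op Y) b) = 1
    rw [hb, map_one]

end RealifiedDivisorMonoids.Prop34Cnst

/-! ### Theorem 3.7 (iii) over the weak-vocabulary constructed data -/

namespace TemperedFrobenioid

variable {D₀ : Type u} [Category.{v} D₀] {dm : DivisorMonoids.{u, v, w} D₀}
  {hpf : ∀ Y : D₀ᵒᵖ, IsPerfFactorialCof (dm.Φ₀.obj Y)} {V : FrdIMonoidStub.{w}}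
  {V₀ : FrdICatStub.{u, v, w} D₀} {D : Type u₀} [Category.{v₀} D] {VD : FrdICatStub.{u₀, v₀, w} D}
  {Dcnst : Type u₁} [Category.{v₁} Dcnst] {cnst : D₀ ⥤ Dcnst}

/-- **Theorem 3.7 (iii) for a tempered Frobenioid (monoid type `ℤ`) over the weak-vocabulary CONSTRUCTED
Def. 3.6 (i) data `ofRlfZWeak dm hpf`**, at the instantiated facade, modulo statements about the Def. 3.3
(iii) data only (`dm.Prop34`, `dm.Prop34Cnst₀ cnst`) — the weak twin of `thm37_iii_withCnst_ofRlfZ` (the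
tempered Frobenioid `C₀` lives over `ofRlfZWeak`, not `ofRlfZ`). [cite: MochizukiEtTh2009, Thm 3.7 (iii) p.79] -/
theorem thm37_iii_withCnst_ofRlfZWeak
    (C₀ : TemperedFrobenioid (RealifiedDivisorMonoids.ofRlfZWeak dm hpf) D VD)
    (F : FrobenioidFacade.{u₀, v₀, w} D) (h34 : dm.Prop34 V V₀) (h₀ : dm.Prop34Cnst₀ cnst) :
    TemperedFrobenioid.Thm37_iii (T := RealifiedDivisorMonoids.ofRlfZWeak dm hpf) C₀ (F.withCnst (C₀.base ⋙ cnst)) :=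
  C₀.thm37_iii_withCnst F (RealifiedDivisorMonoids.Prop34Cnst.ofRlfZWeak h34 h₀)

end TemperedFrobenioid

end Literature.AnabelianGeometry.EtaleTheta

end
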